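import Summits.ResolutionOfSingularities.ResolutionOfSingularities.Theorems.EquisingularLiftEquisingularLiftNatAdaptedFrameRel
import Summits.ResolutionOfSingularities.ResolutionOfSingularities.Theorems.EquisingularLiftEquisingularLiftNatQuasiRegularPairLocal
import Summits.ResolutionOfSingularities.ResolutionOfSingularities.Theorems.EquisingularLiftEquisingularLiftNatDirectionCoordinates
import Literature.AlgebraicGeometry.Resolution.MarkedIdealsLemmas
import Mathlib.RingTheory.LocalProperties.Basic
import HarnessLib

/-!
# [OURS · L1 W4.5(b) · EL♮(3)] T-DIRLIFT-UP (L), brick C2, bridge piece X2 (uniqueness form) — the `cx₁`-coefficient of `cy₀` lies in `Ī`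

Crux chain w45b (cell `res-hironaka`, slot W4.5(b)), child crux **EL♮(3)** = stmt-ResolutionOfSingularities-20148, route EquisingularLift;
object (L), brick C2 (res-type-027 g15's census / cut `L/res-type-027/Bridge-pieces.sig.lean` d74e4ef5f55702f7), bridge piece **X2,
UNIQUENESS form** (res-type-027 AMEND, `res-hironaka/STATUS.md` 2026-08-28T00:25:08Z): the form the (★) assembly
`cechPic_pullback_detClass_conormal_section` actually consumes. Companion of res-L1-w45b-stub-4's EXISTENCE form `exists_adaptedFrame_rel`
(`…NatAdaptedFrameRel`). Written by res-D-pv-035 g9. HONEST FRAMING: OURS; NOT a statement of any manuscript; AI-written, weaker than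
expert review. No `sorry`; standard axioms; DEF-FREE. `--supports stmt-ResolutionOfSingularities-20148 --as helper`.

WHAT.
* `mem_ideal_of_forall_germ_mem_stalkIdeal` — **membership in `I(U)` is stalk-local**: a section `s ∈ Γ(X, U)` (`U` affine) whose germ at
  every point `x ∈ U` lies in the stalk `I_x` lies in `I(U)` (membership in an ideal of `Γ(X, U)` is checked at the maximal ideals, and
  `𝒪_{X,x}` is the localization at the prime of `x`; cf. the tree's `le_of_forall_stalkIdeal_le`).
* `mem_span_of_linearComb_eq_zero_of_adapted` — on an affine `W` where `Ī(W) = (g₀, g₁)` and `Ī` has a quasi-regular adapted stalk frame at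
  every point of its support (hypothesis `hdir'` of B1′, VERBATIM), a relation `u g₀ + w g₁ = 0` forces `u, w ∈ Ī(W)`: at `z ∈ V(Ī)` the germs
  of `(g₀, g₁)` generate `Ī_z`, hence are quasi-regular (res-L1-w45b-stub-3's `IsQuasiRegular.of_span_pair_eq`), so quasi-regularity in
  degree one (res-D-pv-051's `mem_of_linearComb_mem_sq`) puts the germs of `u, w` in `Ī_z`; off `V(Ī)` the stalk is `⊤`; conclude by
  stalk-locality.
* `mem_ideal_of_adaptedFrame_rel` — **X2, uniqueness form**: two adapted frames `cx` on `Wx`, `cy` on `Wy` (`Ī = (cx)` on `Wx`,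
  `𝒟' = (c₀) + Ī²` on both charts) and ANY expansion `cy₀| = a₀ cx₀| + b₀ cx₁|` on an affine `W″` below both ⊢ `b₀ ∈ Ī(W″)`.
  Proof: restricting (`map_secRes_ideal`), `cy₀| ∈ 𝒟'(W″) = (cx₀|) + Ī(W″)²` and `Ī(W″)² = Ī·(cx₀|) + Ī·(cx₁|)`
  (`exists_of_mem_mul_span_pair`) give a second expansion `cy₀| = (t + p) cx₀| + q cx₁|` with `q ∈ Ī(W″)`; subtracting,
  `(a₀ − t − p) cx₀| + (b₀ − q) cx₁| = 0`, so `b₀ − q ∈ Ī(W″)` by the previous lemma. (The binder `hcy : (cy) = Ī(Wy)` of the existence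
  form and `[IsLocallyNoetherian G₀]` are not needed and therefore not taken.)

References (method): H. Matsumura, *Commutative Ring Theory* (1986), §16 (quasi-regular sequences), index only; Stacks Project Tag 00HN
(membership in an ideal is local), index only.
-/

set_option linter.dupNamespace false -- mandated namespace `Summit.<Summit>.<Problem>` of this single-conjunct summit

noncomputable section

open CategoryTheory AlgebraicGeometry Opposite TopologicalSpace IsLocalRing
open Literature.AlgebraicGeometry.Resolution Literature.AlgebraicGeometry.Modules
open AlgebraicGeometry.Scheme.IdealSheafData

namespace Summit.ResolutionOfSingularities.ResolutionOfSingularities.Cruxes.EquisingularLiftNat.Sections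

universe u

/-- **Membership in `I(U)` is stalk-local**: if the germ of `s ∈ Γ(X, U)` (`U` affine) at every point `x ∈ U` lies in the stalk `I_x`,
then `s ∈ I(U)`. [folklore; cf. Stacks Project Tag 00HN] -/
theorem mem_ideal_of_forall_germ_mem_stalkIdeal {X : Scheme.{u}} (I : X.IdealSheafData) (U : X.affineOpens) (s : Γ(X, U))
    (h : ∀ (x : X) (hx : x ∈ (U : X.Opens)), (X.presheaf.germ U x hx).hom s ∈ stalkIdeal I x) :
    s ∈ I.ideal U := by
  suffices hle : Ideal.span {s} ≤ I.ideal U from hle (Ideal.mem_span_singleton_self s)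
  refine Ideal.le_of_localization_maximal fun P hP => ?_
  haveI := hP.isPrime
  -- the point `y ∈ U` of the prime `P ⊆ Γ(X, U)`
  let q : PrimeSpectrum Γ(X, U) := ⟨P, hP.isPrime⟩
  have hy : U.2.fromSpec q ∈ (U : X.Opens) := U.2.range_fromSpec.le ⟨q, rfl⟩
  letI : Algebra Γ(X, U) (X.presheaf.stalk (U.2.fromSpec q)) :=
    (X.presheaf.germ U (U.2.fromSpec q) hy).hom.toAlgebra
  haveI : IsLocalization.AtPrime (X.presheaf.stalk (U.2.fromSpec q)) P :=
    U.2.isLocalization_stalk' q hy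
  -- `𝒪_{X,y}` and `Γ(X, U)_P` are both localizations at `P`
  let e : Localization.AtPrime P ≃ₐ[Γ(X, U)] X.presheaf.stalk (U.2.fromSpec q) :=
    IsLocalization.algEquiv P.primeCompl _ _
  have key : (Ideal.span {s}).map (X.presheaf.germ U (U.2.fromSpec q) hy).hom ≤
      (I.ideal U).map (X.presheaf.germ U (U.2.fromSpec q) hy).hom := by
    rw [Ideal.map_span, Set.image_singleton, Ideal.span_singleton_le_iff_mem, ← stalkIdeal_eq_map_germ I U hy]
    exact h _ hy
  have key' := Ideal.map_mono (f := e.symm.toAlgHom.toRingHom) key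
  rw [Ideal.map_map, Ideal.map_map] at key'
  have hcomp : e.symm.toAlgHom.toRingHom.comp (X.presheaf.germ U (U.2.fromSpec q) hy).hom =
      algebraMap Γ(X, U) (Localization.AtPrime P) :=
    RingHom.ext fun a => e.symm.commutes a
  rwa [hcomp] at key'

/-- **Degree-one uniqueness on an affine chart with adapted stalk frames**: if `Ī(W) = (g₀, g₁)` and `Ī` admits at every point of its
support a quasi-regular stalk frame (hypothesis `hdir'` of B1′), then `u g₀ + w g₁ = 0` in `Γ(G₀, W)` forces `u ∈ Ī(W)` and `w ∈ Ī(W)`.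
[OURS · L1 W4.5b · C2 X2; method: Matsumura1987 §16, index only] -/
theorem mem_ideal_of_linearComb_eq_zero_of_adapted {G₀ : Scheme.{u}} (Ī 𝒟' : G₀.IdealSheafData)
    (hdir' : ∀ z ∈ Ī.support, ∃ c : Fin 2 → G₀.presheaf.stalk z,
      Ideal.span (Set.range c) = stalkIdeal Ī z ∧ IsQuasiRegular c ∧
      stalkIdeal 𝒟' z = Ideal.span {c 0} ⊔ Ideal.span {c 1 * c 1})
    (W : G₀.affineOpens) (g : Fin 2 → Γ(G₀, (W : G₀.Opens))) (hg : Ideal.span (Set.range g) = Ī.ideal W)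
    {u w : Γ(G₀, (W : G₀.Opens))} (hlin : u * g 0 + w * g 1 = 0) :
    u ∈ Ī.ideal W ∧ w ∈ Ī.ideal W := by
  -- both memberships are stalk-local
  suffices key : ∀ (z : G₀) (hz : z ∈ (W : G₀.Opens)),
      (G₀.presheaf.germ W z hz).hom u ∈ stalkIdeal Ī z ∧ (G₀.presheaf.germ W z hz).hom w ∈ stalkIdeal Ī z from
    ⟨mem_ideal_of_forall_germ_mem_stalkIdeal Ī W u fun z hz => (key z hz).1,
      mem_ideal_of_forall_germ_mem_stalkIdeal Ī W w fun z hz => (key z hz).2⟩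
  intro z hz
  by_cases hzS : z ∈ Ī.support
  · obtain ⟨c, hcspan, hcqr, -⟩ := hdir' z hzS
    -- the germs of the chart frame generate `Ī_z = (c)`, hence are quasi-regular
    set γ : Fin 2 → G₀.presheaf.stalk z := fun j => (G₀.presheaf.germ W z hz).hom (g j) with hγ
    have hγspan : Ideal.span (Set.range γ) = stalkIdeal Ī z := by
      rw [stalkIdeal_eq_map_germ Ī W hz, ← hg, Ideal.map_span, ← Set.range_comp, hγ]
      rfl
    have hγqr : IsQuasiRegular γ :=
      IsQuasiRegular.of_span_pair_eq hcqr (hcspan ▸ (mem_support_iff_stalkIdeal_le Ī z).mp hzS)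
        (hγspan.trans hcspan.symm)
    -- the relation at the stalk: `u_z γ₀ + w_z γ₁ = 0 ∈ (γ)²`
    have h0 : (G₀.presheaf.germ W z hz).hom u * γ 0 + (G₀.presheaf.germ W z hz).hom w * γ 1 ∈
        Ideal.span (Set.range γ) ^ 2 := by
      have := congrArg (G₀.presheaf.germ W z hz).hom hlin
      rw [map_add, map_mul, map_mul, map_zero] at this
      rw [hγ]
      simp only
      rw [this]
      exact zero_mem _
    have h1 := mem_of_linearComb_mem_sq hγqr h0
    rwa [hγspan] at h1
  · rw [stalkIdeal_eq_top_of_not_mem_support hzS]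
    exact ⟨Submodule.mem_top, Submodule.mem_top⟩

/-- **X2, uniqueness form — the `cx₁`-coefficient of `cy₀` lies in `Ī`.** Two adapted frames `cx` on `Wx` (`Ī(Wx) = (cx)`,
`𝒟'(Wx) = (cx₀) + Ī(Wx)²`) and `cy` on `Wy` (`𝒟'(Wy) = (cy₀) + Ī(Wy)²`), an affine `W″` below both, and ANY expansion
`cy₀|_{W″} = a₀ · cx₀|_{W″} + b₀ · cx₁|_{W″}`: then `b₀ ∈ Ī(W″)`, provided `Ī` has quasi-regular adapted stalk frames along its support
(hypothesis `hdir'` of B1′, VERBATIM). This is exactly the side condition `b₀ ∈ Ī(W″)` of B1c's `hrel₀`. See the module docstring.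
[OURS · L1 W4.5b · C2 X2 (res-type-027 AMEND 2026-08-28T00:25:08Z)] -/
theorem mem_ideal_of_adaptedFrame_rel {G₀ : Scheme.{0}} (Ī 𝒟' : G₀.IdealSheafData)
    (hdir' : ∀ z ∈ Ī.support, ∃ c : Fin 2 → G₀.presheaf.stalk z,
      Ideal.span (Set.range c) = stalkIdeal Ī z ∧ IsQuasiRegular c ∧
      stalkIdeal 𝒟' z = Ideal.span {c 0} ⊔ Ideal.span {c 1 * c 1})
    (Wx Wy W'' : G₀.affineOpens)
    (cx : Fin 2 → Γ(G₀, (Wx : G₀.Opens))) (cy : Fin 2 → Γ(G₀, (Wy : G₀.Opens)))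
    (hcx : Ideal.span (Set.range cx) = Ī.ideal Wx)
    (h𝒟x : 𝒟'.ideal Wx = Ideal.span {cx 0} ⊔ (Ī.ideal Wx) ^ 2) (h𝒟y : 𝒟'.ideal Wy = Ideal.span {cy 0} ⊔ (Ī.ideal Wy) ^ 2)
    (hx'' : (W'' : G₀.Opens) ≤ Wx) (hy'' : (W'' : G₀.Opens) ≤ Wy)
    (a₀ b₀ : Γ(G₀, (W'' : G₀.Opens)))
    (hrel₀ : G₀.presheaf.map (homOfLE hy'').op (cy 0) =
      a₀ * G₀.presheaf.map (homOfLE hx'').op (cx 0) + b₀ * G₀.presheaf.map (homOfLE hx'').op (cx 1)) :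
    b₀ ∈ Ī.ideal W'' := by
  -- notation: the restricted frames
  let rx : Γ(G₀, (Wx : G₀.Opens)) →+* Γ(G₀, (W'' : G₀.Opens)) := secRes G₀ hx''
  let ry : Γ(G₀, (Wy : G₀.Opens)) →+* Γ(G₀, (W'' : G₀.Opens)) := secRes G₀ hy''
  have hrange : ∀ {V : G₀.affineOpens} (c : Fin 2 → Γ(G₀, (V : G₀.Opens))), Set.range c = {c 0, c 1} := by
    intro V c
    ext t
    simp only [Set.mem_range, Set.mem_insert_iff, Set.mem_singleton_iff]
    constructor
    · rintro ⟨i, rfl⟩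
      rcases Fin.exists_fin_two.mp ⟨i, rfl⟩ with rfl | rfl
      · exact Or.inl rfl
      · exact Or.inr rfl
    · rintro (rfl | rfl)
      · exact ⟨0, rfl⟩
      · exact ⟨1, rfl⟩
  -- `Ī(W'') = (cx 0|, cx 1|)`, as a range and as a pair
  have hIx : Ideal.span (Set.range fun j => rx (cx j)) = Ī.ideal W'' := by
    rw [← map_secRes_ideal Ī hx'', ← hcx, Ideal.map_span, ← Set.range_comp]
    rfl
  have hIx' : Ī.ideal W'' = Ideal.span {rx (cx 0), rx (cx 1)} := by
    rw [← hIx, hrange]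
  -- `𝒟'(W'') = (cx 0|) + Ī(W'')²` and `cy 0| ∈ 𝒟'(W'')`
  have hDx : 𝒟'.ideal W'' = Ideal.span {rx (cx 0)} ⊔ (Ī.ideal W'') ^ 2 := by
    rw [← map_secRes_ideal 𝒟' hx'', h𝒟x, Ideal.map_sup, Ideal.map_pow, Ideal.map_span, Set.image_singleton, map_secRes_ideal Ī hx'']
  have hcy0 : ry (cy 0) ∈ Ideal.span {rx (cx 0)} ⊔ (Ī.ideal W'') ^ 2 := by
    rw [← hDx, ← map_secRes_ideal 𝒟' hy'']
    exact Ideal.mem_map_of_mem _ (h𝒟y ▸ Ideal.mem_sup_left (Ideal.mem_span_singleton_self _))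
  -- the second expansion `cy 0| = (t + p) cx 0| + q cx 1|`, `q ∈ Ī(W'')`
  obtain ⟨za, hza, zb, hzb, hsum⟩ := Submodule.mem_sup.mp hcy0
  obtain ⟨t, rfl⟩ := Ideal.mem_span_singleton'.mp hza
  have hzb' : zb ∈ Ī.ideal W'' * Ideal.span {rx (cx 0), rx (cx 1)} := by
    rw [← hIx', ← pow_two]; exact hzb
  obtain ⟨p, q, -, hq, rfl⟩ := exists_of_mem_mul_span_pair _ _ _ _ hzb'
  -- subtract: `(a₀ - t - p) cx 0| + (b₀ - q) cx 1| = 0`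
  have hrel₀' : ry (cy 0) = a₀ * rx (cx 0) + b₀ * rx (cx 1) := hrel₀
  have hlin : (a₀ - t - p) * rx (cx 0) + (b₀ - q) * rx (cx 1) = 0 := by
    have h := hsum.trans hrel₀'
    linear_combination -h
  -- degree-one uniqueness: `b₀ - q ∈ Ī(W'')`
  have hmem := (mem_ideal_of_linearComb_eq_zero_of_adapted Ī 𝒟' hdir' W'' (fun j => rx (cx j)) hIx hlin).2
  simpa using Ideal.add_mem _ hmem hq

end Summit.ResolutionOfSingularities.ResolutionOfSingularities.Cruxes.EquisingularLiftNat.Sections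

end
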